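import Mathlib
import Summits.CriticalPhenomena.Ising3DConformalLimit.Theorems.PrecisionLaplacianTwoPointSpineGlueRays
import HarnessLib

/-!
# TwoPointSpineGlue (route PrecisionLaplacian, item stmt-CriticalPhenomena-4805) — the Tauberian step, II:
# the limit kernel is continuous, positive, homogeneous, and the convergence is uniform in the direction

Helper file 17.  Abstract setting of `…TwoPointSpineGlueRays`: `G : ℤ³ → ℝ` Lipschitz at scale (constants
`C, s`), with block scaling limits around every ray, and with a lower bound `G(z) ≥ c₀‖z‖^{-s}`.  Let
`k(w) = lim_N N^s G(⌊Nw⌋)` be the ray limits (`ray_limit`).  Then: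

* `rayLimit_lipschitz` — `|k(w') − k(w)| ≤ 3C(8/ρ)^{s+1} ‖w' − w‖` for `‖w‖ ≥ ρ`, `‖w' − w‖ ≤ ρ/48`;
* `rayLimit_homogeneous` — `k(c w) = c^{-s} k(w)` (`c > 0`; rational `c` by subsequences, then density);
* `rayLimit_pos` — `k(w) ≥ c₀ (2‖w‖)^{-s} > 0`;
* `exists_limit_kernel` — **there is `U : ℝ³ → ℝ`, continuous and positive off `0`, homogeneous of degree
  `-s`, with `G(x)‖x‖₂^s − U(x/‖x‖₂) → 0` at infinity on `ℤ³`** (uniformity in the direction by a finite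
  `δ`-net of rays, the Lipschitz bound at scale, and the Lipschitz continuity of `k`).

No definitions are introduced (the kernel is `limUnder` of the ray sequences, extended by `0` at the origin).
-/

noncomputable section

namespace Summit.CriticalPhenomena.Ising3DConformalLimit.Theorems.SpineGlue

open Finset Real Filter Topology Literature.Probability.LatticeModels

section Tauberian

variable {G : Site 3 → ℝ} {C s : ℝ}

/-- **The ray limits are locally Lipschitz**: `|k(w') − k(w)| ≤ 3C(8/ρ)^{s+1}‖w' − w‖` for `‖w‖ ≥ ρ > 0` and
`‖w' − w‖ ≤ ρ/48`, where `k(w)`, `k(w')` are the limits of `N^s G(⌊Nw⌋)`, `N^s G(⌊Nw'⌋)`. -/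
theorem rayLimit_lipschitz (hs : 0 < s) (hC : 0 ≤ C)
    (hLip : ∀ z z' : Site 3, 16 ≤ ‖z‖ → (∑ l, |((z' l - z l : ℤ) : ℝ)|) ≤ ‖z‖ / 2 →
      |G z' - G z| ≤ C * (∑ l, |((z' l - z l : ℤ) : ℝ)|) * ‖z‖ ^ (-(s + 1)))
    {ρ : ℝ} (hρ : 0 < ρ) {w w' : EuclideanSpace ℝ (Fin 3)} (hw : ρ ≤ ‖w‖) (hww' : ‖w' - w‖ ≤ ρ / 48)
    {kw kw' : ℝ}
    (hkw : Tendsto (fun N : ℕ => (N : ℝ) ^ s * G (latticeApprox ((N : ℝ)⁻¹) w)) atTop (𝓝 kw))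
    (hkw' : Tendsto (fun N : ℕ => (N : ℝ) ^ s * G (latticeApprox ((N : ℝ)⁻¹) w')) atTop (𝓝 kw')) :
    |kw' - kw| ≤ 3 * C * (8 / ρ) ^ (s + 1) * ‖w' - w‖ := by
  have hdiff : Tendsto (fun N : ℕ => |(N : ℝ) ^ s * G (latticeApprox ((N : ℝ)⁻¹) w')
      - (N : ℝ) ^ s * G (latticeApprox ((N : ℝ)⁻¹) w)|) atTop (𝓝 |kw' - kw|) := (hkw'.sub hkw).abs
  have hbound : Tendsto (fun N : ℕ => 3 * C * (8 / ρ) ^ (s + 1) * (‖w' - w‖ + 4 / N)) atTop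
      (𝓝 (3 * C * (8 / ρ) ^ (s + 1) * (‖w' - w‖ + 0))) := by
    refine Tendsto.const_mul _ (tendsto_const_nhds.add ?_)
    have : Tendsto (fun N : ℕ => 4 * (N : ℝ)⁻¹) atTop (𝓝 (4 * 0)) :=
      (tendsto_inv_atTop_zero.comp tendsto_natCast_atTop_atTop).const_mul 4
    rw [mul_zero] at this
    exact this.congr fun N => by rw [div_eq_mul_inv]
  rw [add_zero] at hbound
  refine le_of_tendsto_of_tendsto hdiff hbound ?_
  obtain ⟨N₀, hN₀⟩ := exists_nat_ge (200 / ρ)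
  filter_upwards [eventually_ge_atTop N₀] with N hN
  have hNρ : 200 ≤ (N : ℝ) * ρ := by
    have : (N₀ : ℝ) ≤ N := by exact_mod_cast hN
    rw [div_le_iff₀ hρ] at hN₀; nlinarith
  have h := ray_compare hs hC hLip hρ hw hww' hNρ
  rw [← mul_sub, abs_mul, abs_of_nonneg (Real.rpow_nonneg (Nat.cast_nonneg N) _)]
  exact h

/-- `⌊c n⌋/n → c` for `c ≥ 0`. -/
theorem tendsto_floor_mul_div {c : ℝ} (hc : 0 ≤ c) :
    Tendsto (fun n : ℕ => (⌊c * n⌋₊ : ℝ) / n) atTop (𝓝 c) := by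
  have hinv : Tendsto (fun N : ℕ => (N : ℝ)⁻¹) atTop (𝓝 0) :=
    tendsto_inv_atTop_zero.comp tendsto_natCast_atTop_atTop
  refine tendsto_of_tendsto_of_tendsto_of_le_of_le' (g := fun N : ℕ => c - (N : ℝ)⁻¹)
    (h := fun N : ℕ => c) ?_ tendsto_const_nhds ?_ ?_
  · simpa using tendsto_const_nhds.sub hinv
  · filter_upwards [eventually_ge_atTop 1] with N hN
    have hN : (0 : ℝ) < N := by exact_mod_cast hN
    have hfl : c * N - 1 ≤ (⌊c * N⌋₊ : ℝ) := by
      have := Nat.lt_floor_add_one (c * N); linarith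
    rw [le_div_iff₀ hN]
    have : (c - (N : ℝ)⁻¹) * N = c * N - 1 := by field_simp
    rw [this]; exact hfl
  · filter_upwards [eventually_ge_atTop 1] with N hN
    have hN : (0 : ℝ) < N := by exact_mod_cast hN
    rw [div_le_iff₀ hN]
    exact Nat.floor_le (by positivity)

/-- Rational dilations commute with the lattice approximation along a subsequence:
`⌊(qm)·((p/q) w)⌋ = ⌊(pm)·w⌋`. -/
theorem latticeApprox_rat_smul {p q : ℕ} (hq : 0 < q) (m : ℕ) (w : EuclideanSpace ℝ (Fin 3)) :
    latticeApprox (((q * m : ℕ) : ℝ)⁻¹) (((p : ℝ) / q) • w) = latticeApprox (((p * m : ℕ) : ℝ)⁻¹) w := by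
  funext i
  simp only [latticeApprox_apply, PiLp.smul_apply, smul_eq_mul, div_inv_eq_mul]
  congr 1
  have hq' : (q : ℝ) ≠ 0 := by exact_mod_cast hq.ne'
  push_cast
  field_simp

/-- **Homogeneity of the ray limits**: `k(c w) = c^{-s} k(w)` for `c > 0`, `w ≠ 0` — for rational `c = p/q`
through the subsequences `N = qm`, `N = pm`; for real `c` by continuity of `k` at `c w` and density. -/
theorem rayLimit_homogeneous (hs : 0 < s) (hC : 0 ≤ C)
    (hLip : ∀ z z' : Site 3, 16 ≤ ‖z‖ → (∑ l, |((z' l - z l : ℤ) : ℝ)|) ≤ ‖z‖ / 2 →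
      |G z' - G z| ≤ C * (∑ l, |((z' l - z l : ℤ) : ℝ)|) * ‖z‖ ^ (-(s + 1)))
    {k : EuclideanSpace ℝ (Fin 3) → ℝ}
    (hk : ∀ w : EuclideanSpace ℝ (Fin 3), w ≠ 0 →
      Tendsto (fun N : ℕ => (N : ℝ) ^ s * G (latticeApprox ((N : ℝ)⁻¹) w)) atTop (𝓝 (k w)))
    {w : EuclideanSpace ℝ (Fin 3)} (hw : w ≠ 0) {c : ℝ} (hc : 0 < c) :
    k (c • w) = c ^ (-s) * k w := by
  -- rational dilations
  have hrat : ∀ p q : ℕ, 0 < p → 0 < q → k (((p : ℝ) / q) • w) = ((p : ℝ) / q) ^ (-s) * k w := by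
    intro p q hp hq
    have hpq : (0 : ℝ) < (p : ℝ) / q := by positivity
    have hcw : ((p : ℝ) / q) • w ≠ 0 := smul_ne_zero hpq.ne' hw
    -- along `N = q m`
    have h1 : Tendsto (fun m : ℕ => (((q * m : ℕ) : ℝ)) ^ s * G (latticeApprox (((q * m : ℕ) : ℝ)⁻¹)
        (((p : ℝ) / q) • w))) atTop (𝓝 (k (((p : ℝ) / q) • w))) :=
      (hk _ hcw).comp (tendsto_id.const_mul_atTop' hq)
    -- along `N = p m`
    have h2 : Tendsto (fun m : ℕ => (((p * m : ℕ) : ℝ)) ^ s * G (latticeApprox (((p * m : ℕ) : ℝ)⁻¹) w))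
        atTop (𝓝 (k w)) :=
      (hk w hw).comp (tendsto_id.const_mul_atTop' hp)
    have h3 : Tendsto (fun m : ℕ => ((q : ℝ) / p) ^ s * ((((p * m : ℕ) : ℝ)) ^ s *
        G (latticeApprox (((p * m : ℕ) : ℝ)⁻¹) w))) atTop (𝓝 (((q : ℝ) / p) ^ s * k w)) :=
      h2.const_mul _
    have heq : ∀ m : ℕ, (((q * m : ℕ) : ℝ)) ^ s * G (latticeApprox (((q * m : ℕ) : ℝ)⁻¹) (((p : ℝ) / q) • w))
        = ((q : ℝ) / p) ^ s * ((((p * m : ℕ) : ℝ)) ^ s * G (latticeApprox (((p * m : ℕ) : ℝ)⁻¹) w)) := by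
      intro m
      rw [latticeApprox_rat_smul hq m w, ← mul_assoc]
      congr 1
      have hp' : (0 : ℝ) < p := by exact_mod_cast hp
      have hq' : (0 : ℝ) < q := by exact_mod_cast hq
      push_cast
      rw [← Real.mul_rpow (by positivity) (by positivity)]
      congr 1
      field_simp
    have h1' := h1.congr heq
    have hlim := tendsto_nhds_unique h1' h3
    rw [hlim]
    congr 1
    rw [Real.rpow_neg hpq.le, ← Real.inv_rpow hpq.le, inv_div]
  -- real dilations by density and continuity of `k` at `c • w`
  have hcw : c • w ≠ 0 := smul_ne_zero hc.ne' hw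
  set cn : ℕ → ℝ := fun n => (⌊c * n⌋₊ : ℝ) / n with hcn
  have hcn_lim : Tendsto cn atTop (𝓝 c) := tendsto_floor_mul_div hc.le
  -- continuity of `k` at `c • w` (from the Lipschitz bound)
  have hcont : Tendsto (fun n => k (cn n • w)) atTop (𝓝 (k (c • w))) := by
    have hsm : Tendsto (fun n => cn n • w) atTop (𝓝 (c • w)) := hcn_lim.smul_const w
    rw [Metric.tendsto_nhds]
    intro ε hε
    set ρ : ℝ := ‖c • w‖ with hρ
    have hρ0 : 0 < ρ := norm_pos_iff.2 hcw
    set Kρ : ℝ := 3 * C * (8 / ρ) ^ (s + 1) with hKρ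
    have hKρ0 : 0 ≤ Kρ := by positivity
    have hnear : ∀ᶠ n in atTop, ‖cn n • w - c • w‖ < min (ρ / 48) (ε / (Kρ + 1)) :=
      (Metric.tendsto_nhds.1 hsm) _ (lt_min (by positivity) (by positivity))
    have hpos : ∀ᶠ n in atTop, 0 < cn n := hcn_lim.eventually (lt_mem_nhds hc)
    filter_upwards [hnear, hpos] with n hn hn0
    have hne : cn n • w ≠ 0 := smul_ne_zero hn0.ne' hw
    have hle := rayLimit_lipschitz hs hC hLip hρ0 (le_refl ρ)
      ((min_le_left _ _).trans' hn.le) (hk _ hcw) (hk _ hne)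
    rw [Real.dist_eq]
    calc |k (cn n • w) - k (c • w)| ≤ Kρ * ‖cn n • w - c • w‖ := hle
      _ ≤ Kρ * (ε / (Kρ + 1)) := mul_le_mul_of_nonneg_left ((min_le_right _ _).trans' hn.le) hKρ0
      _ < ε := by rw [mul_div_assoc', div_lt_iff₀ (by positivity)]; nlinarith
  -- the rational identity along `cn`
  have hratn : ∀ᶠ n in atTop, k (cn n • w) = (cn n) ^ (-s) * k w := by
    have hpos : ∀ᶠ n : ℕ in atTop, 0 < ⌊c * n⌋₊ := by
      have : ∀ᶠ n : ℕ in atTop, 1 ≤ c * n := by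
        have ht : Tendsto (fun n : ℕ => c * n) atTop atTop :=
          tendsto_natCast_atTop_atTop.const_mul_atTop hc
        exact ht.eventually_ge_atTop 1
      filter_upwards [this] with n hn
      exact Nat.floor_pos.2 hn
    filter_upwards [hpos, eventually_gt_atTop 0] with n hn hn0
    exact hrat ⌊c * n⌋₊ n hn hn0
  have hlim2 : Tendsto (fun n => (cn n) ^ (-s) * k w) atTop (𝓝 (c ^ (-s) * k w)) :=
    ((Real.continuousAt_rpow_const c (-s) (Or.inl hc.ne')).tendsto.comp hcn_lim).mul_const _
  exact tendsto_nhds_unique (hcont.congr' hratn) hlim2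

/-- **Positivity of the ray limits**: `k(w) ≥ c₀ (2‖w‖)^{-s}` when `G(z) ≥ c₀ ‖z‖^{-s}` off the origin. -/
theorem rayLimit_pos (hs : 0 < s) {c₀ : ℝ} (hc₀ : 0 < c₀)
    (hlo : ∀ z : Site 3, z ≠ 0 → c₀ * ‖z‖ ^ (-s) ≤ G z)
    {w : EuclideanSpace ℝ (Fin 3)} (hw : w ≠ 0) {kw : ℝ}
    (hkw : Tendsto (fun N : ℕ => (N : ℝ) ^ s * G (latticeApprox ((N : ℝ)⁻¹) w)) atTop (𝓝 kw)) :
    c₀ * (2 * ‖w‖) ^ (-s) ≤ kw := by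
  have hwn : 0 < ‖w‖ := norm_pos_iff.2 hw
  refine ge_of_tendsto hkw ?_
  obtain ⟨N₀, hN₀⟩ := exists_nat_ge (4 / ‖w‖)
  filter_upwards [eventually_ge_atTop N₀, eventually_gt_atTop 0] with N hN hNpos
  have hNr : (0 : ℝ) < N := by exact_mod_cast hNpos
  have hN4 : 4 ≤ (N : ℝ) * ‖w‖ := by
    have : (N₀ : ℝ) ≤ N := by exact_mod_cast hN
    rw [div_le_iff₀ hwn] at hN₀; nlinarith
  set z := latticeApprox ((N : ℝ)⁻¹) w with hz
  have hzlo : ((N : ℝ) * ‖w‖ - 2) / 2 ≤ ‖z‖ := norm_latticeApprox_ge N w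
  have hzhi : ‖z‖ ≤ (N : ℝ) * ‖w‖ + 2 := norm_latticeApprox_le N w
  have hzpos : 0 < ‖z‖ := by linarith
  have hz0 : z ≠ 0 := norm_pos_iff.1 hzpos
  have h1 := hlo z hz0
  have h2 : (2 * ((N : ℝ) * ‖w‖)) ^ (-s) ≤ ‖z‖ ^ (-s) :=
    Real.rpow_le_rpow_of_nonpos hzpos (by linarith) (by linarith)
  have h3 : (N : ℝ) ^ s * (2 * ((N : ℝ) * ‖w‖)) ^ (-s) = (2 * ‖w‖) ^ (-s) := by
    rw [show 2 * ((N : ℝ) * ‖w‖) = (N : ℝ) * (2 * ‖w‖) by ring, Real.mul_rpow hNr.le (by positivity),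
      Real.rpow_neg hNr.le, ← mul_assoc, mul_inv_cancel₀ (Real.rpow_pos_of_pos hNr _).ne', one_mul]
  calc c₀ * (2 * ‖w‖) ^ (-s) = (N : ℝ) ^ s * (c₀ * (2 * ((N : ℝ) * ‖w‖)) ^ (-s)) := by rw [← h3]; ring
    _ ≤ (N : ℝ) ^ s * (c₀ * ‖z‖ ^ (-s)) := by gcongr
    _ ≤ (N : ℝ) ^ s * G z := mul_le_mul_of_nonneg_left h1 (Real.rpow_nonneg hNr.le _)

end Tauberian

end Summit.CriticalPhenomena.Ising3DConformalLimit.Theorems.SpineGlue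

end
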